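import Summits.Ventures.HodgeRepro2.T5WeightDecomposition
import Summits.Ventures.HodgeRepro2.T5CircleCharacters

/-!
# T5CircleWeights — the weights of a continuous representation of the circle group are integers

Support (seat p1, blind lane) for route/T5-N4-p5.md v10 (N4.3 = (R3), rows P2′ «the SO(2)-weights are
exactly {3, 5, 7, …}») — the bridge between the weight decomposition of a compact abelian group
(T5WeightDecomposition, T5WeightSpaces) and the classification of the continuous characters of the
circle (T5CircleCharacters): for `K = Circle` every weight of a continuous finite-dimensional
representation is `z ↦ z ^ n` for an integer `n`, the multiplicity of the weight `n` is the `n`-th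
Fourier coefficient of the character, and `V = ⨁_{n ∈ ℤ} V_n`.

Main statements:
* `zpowChar n : Circle →* ℂˣ` — the character `z ↦ z ^ n`; `coe_zpowChar_apply`, `zpowChar_injective`;
* `exists_zpow_eq_lineWeight` / `exists_lineWeight_eq_zpowChar` — every `lineWeight` of a stable line is
  `zpowChar n` for a unique integer `n` (`lineWeight_int`, `lineWeight_eq_zpowChar_lineWeight_int`);
* `finrank_weightSpace_zpowChar_eq_integral` — `dim V_n = ∫ χ_π(z) · conj (z ^ n) dμ` for any
  left-invariant probability measure `μ` on `Circle`;
* `iSup_weightSpace_zpowChar_eq_top` — the integer weight spaces span `V`.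

Honest scope: nothing about (N), U(1,1), π₃⁺ or the particular weights {3, 5, 7, …}; `Circle` stands
for SO(2) through T5CayleySU11's matrix parametrisation, which is not re-proved here.
-/

namespace Summit.Ventures.HodgeRepro2.T5CircleWeights

open Summit.Ventures.HodgeRepro2 Complex

/-- The character `z ↦ z ^ n` of the circle group, as a monoid homomorphism into `ℂˣ`. -/
noncomputable def zpowChar (n : ℤ) : Circle →* ℂˣ := Circle.toUnits.comp (zpowGroupHom n)

/-- `zpowChar n z = z ^ n` as complex numbers. -/
@[simp] theorem coe_zpowChar_apply (n : ℤ) (z : Circle) : ((zpowChar n z : ℂˣ) : ℂ) = (z : ℂ) ^ n := by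
  simp [zpowChar, zpowGroupHom]

/-- Distinct integers give distinct characters. -/
theorem zpowChar_injective : Function.Injective zpowChar := by
  intro n m h
  apply T5CircleCharacters.zpow_injective
  intro z
  have := congrArg (fun χ : Circle →* ℂˣ => ((χ z : ℂˣ) : ℂ)) h
  simp only [coe_zpowChar_apply] at this
  exact Circle.coe_injective (by simpa using this)

/-- A continuous unimodular character of the circle group equals some `zpowChar n`. -/
theorem eq_zpowChar_of_continuous (χ : Circle →* ℂˣ) (hχ : Continuous fun z => (χ z : ℂ))
    (hnorm : ∀ z, ‖(χ z : ℂ)‖ = 1) : ∃ n : ℤ, χ = zpowChar n := by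
  obtain ⟨n, hn⟩ := T5CircleCharacters.exists_zpow_eq_of_norm_eq_one χ hχ hnorm
  refine ⟨n, MonoidHom.ext fun z => Units.ext ?_⟩
  rw [hn z, coe_zpowChar_apply]

section Weights

variable {V : Type*} [NormedAddCommGroup V] [InnerProductSpace ℂ V] [FiniteDimensional ℂ V]
  [MeasurableSpace Circle] [BorelSpace Circle]
  (π : Circle →* V →L[ℂ] V) (hπ : Continuous π)

include hπ in
/-- Every weight of a stable line of a continuous representation of `Circle` is `z ↦ z ^ n`. -/
theorem exists_zpow_eq_lineWeight {W : Submodule ℂ V}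
    (hW : T5CompleteReducibility.IsIrreducibleSubspace π W) :
    ∃ n : ℤ, ∀ z : Circle, ((T5WeightDecomposition.lineWeight π hW z : ℂˣ) : ℂ) = (z : ℂ) ^ n :=
  T5CircleCharacters.exists_zpow_eq_of_norm_eq_one _
    (T5WeightDecomposition.continuous_lineWeight π hπ hW)
    (T5WeightDecomposition.norm_lineWeight_eq_one π hπ hW)

include hπ in
/-- Every weight of a stable line is `zpowChar n` for a unique integer `n`. -/
theorem exists_lineWeight_eq_zpowChar {W : Submodule ℂ V}
    (hW : T5CompleteReducibility.IsIrreducibleSubspace π W) :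
    ∃! n : ℤ, T5WeightDecomposition.lineWeight π hW = zpowChar n := by
  obtain ⟨n, hn⟩ := eq_zpowChar_of_continuous _
    (T5WeightDecomposition.continuous_lineWeight π hπ hW)
    (T5WeightDecomposition.norm_lineWeight_eq_one π hπ hW)
  exact ⟨n, hn, fun m hm => zpowChar_injective (hm.symm.trans hn)⟩

/-- The integer weight of a stable line of a continuous representation of `Circle`. -/
noncomputable def lineWeightInt {W : Submodule ℂ V}
    (hW : T5CompleteReducibility.IsIrreducibleSubspace π W) : ℤ :=
  (exists_lineWeight_eq_zpowChar π hπ hW).choose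

/-- The weight of a stable line is `z ↦ z ^ (lineWeightInt)`. -/
theorem lineWeight_eq_zpowChar_lineWeightInt {W : Submodule ℂ V}
    (hW : T5CompleteReducibility.IsIrreducibleSubspace π W) :
    T5WeightDecomposition.lineWeight π hW = zpowChar (lineWeightInt π hπ hW) :=
  (exists_lineWeight_eq_zpowChar π hπ hW).choose_spec.1

/-- `π z` acts on the chosen vector of a stable line by `z ^ (lineWeightInt)`. -/
theorem apply_lineVector_zpow {W : Submodule ℂ V}
    (hW : T5CompleteReducibility.IsIrreducibleSubspace π W) (z : Circle) :
    π z (T5WeightDecomposition.lineVector π hW) =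
      ((z : ℂ) ^ lineWeightInt π hπ hW) • T5WeightDecomposition.lineVector π hW := by
  rw [T5WeightDecomposition.apply_lineVector, lineWeight_eq_zpowChar_lineWeightInt π hπ hW,
    coe_zpowChar_apply]

include hπ in
/-- The multiplicity of the weight `n` is the `n`-th Fourier coefficient of the character:
`dim V_n = ∫ χ_π(z) · conj (z ^ n) dμ` for any left-invariant probability measure `μ` on `Circle`. -/
theorem finrank_weightSpace_zpowChar_eq_integral (μ : MeasureTheory.Measure Circle)
    [MeasureTheory.IsProbabilityMeasure μ] [μ.IsMulLeftInvariant] (n : ℤ) :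
    (Module.finrank ℂ (T5WeightSpaces.weightSpace π (zpowChar n)) : ℂ) =
      ∫ z, T5SchurOrthogonality.character π z * (starRingEnd ℂ) ((z : ℂ) ^ n) ∂μ := by
  have h := T5WeightSpaces.finrank_weightSpace_eq_integral μ π (zpowChar n) hπ
    (by
      simp only [coe_zpowChar_apply]
      exact (continuous_subtype_val : Continuous fun z : Circle => (z : ℂ)).zpow₀ n
        (fun z => Or.inl (Circle.coe_ne_zero z)))
    (fun z => by simp)
  simpa only [coe_zpowChar_apply] using h

include hπ in
/-- The integer weight spaces span `V`: `⨆ n : ℤ, V_n = ⊤`. -/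
theorem iSup_weightSpace_zpowChar_eq_top :
    ⨆ n : ℤ, T5WeightSpaces.weightSpace π (zpowChar n) = ⊤ := by
  obtain ⟨S, hS, -, -, -, htop⟩ := T5WeightDecomposition.exists_weight_decomposition π hπ
  apply top_le_iff.1
  rw [← htop]
  apply iSup_le
  intro W
  rw [lineWeight_eq_zpowChar_lineWeightInt π hπ (hS W W.2)]
  exact le_iSup (fun n : ℤ => T5WeightSpaces.weightSpace π (zpowChar n)) _

end Weights

end Summit.Ventures.HodgeRepro2.T5CircleWeights
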